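import Mathlib
import Literature.Combinatorics.Additive.TripleProductProperty
import Literature.Computability.AlgebraicComplexity.GroupTheoreticMatMulThmBProofs

/-!
# The abelian `k`-triple ceiling: an STPP certificate at `w` in an abelian group needs `k > |H|^{1 − w/3}`

Support file for route `MatrixMultiplication/GroupTheoreticSTPP` (target `CThesis`, stmt-MatrixMultiplication-0593),
cell `mm-stpp` (D-0046), CENSUS-PLAN §4 F3 / Q3.4 («fat pairs») and §9 (phase diagram).  In an ABELIAN host
every character degree is `1`, so the Cohn–Umans / CKSU certificate for `ω ≤ w` from an STPP family
`(Aᵢ, Bᵢ, Cᵢ)_{i ∈ ι}` reads `|H| < Σᵢ (|Aᵢ||Bᵢ||Cᵢ|)^{w/3}`; and every triple of an STPP family in an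
abelian group has volume `|Aᵢ||Bᵢ||Cᵢ| ≤ |H|` (Cohn–Umans 2003, Lemma 3.1; tree
`AddSimultaneousTPP.card_mul_card_mul_card_le`).  Hence (`card_rpow_lt_card_of_certificate`)
`|H|^{1 − w/3} < k := |ι|`, i.e. **`k` triples in an abelian group of order `N` certify nothing below
`w = 3(1 − log k / log N)`**, whatever their shapes.  Census consequences (planner's hand arithmetic, now
kernel): `card_lt_64_of_pair_certificate` — an STPP PAIR (`k ≤ 2`) certifying `w ≤ 5/2` (tier T_E) lives in
an abelian group of order `< 64`; `card_lt_of_pair_certificate_fourteen_fifths` — a pair certifying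
`w ≤ 14/5` (tier T_F) needs order `< 2¹⁵ = 32768` (so `Cyc_n³` with `n ≤ 31`); in general
`card_lt_pow_of_certificate`: `|H| < k^m` as soon as `m (3 − w) ≥ 3`.

WHAT THIS IS NOT: an obstruction for abelian hosts and small `k` only (the free template with `k → ∞`
is untouched); no `ω` claim.

## References
* H. Cohn, C. Umans, FOCS 2003, Lemma 3.1; H. Cohn, R. Kleinberg, B. Szegedy, C. Umans, FOCS 2005, Thm. 5.5.
-/

-- single-conjunct summit: the mandated namespace repeats `MatrixMultiplication`.
set_option linter.dupNamespace false

namespace Summit.MatrixMultiplication.MatrixMultiplication.Theorems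

namespace STPPAbelianCeiling

open Finset Literature.Combinatorics.Additive

variable {H : Type} [AddCommGroup H] [Fintype H] {ι : Type} [Fintype ι] {A B C : ι → Finset H}

/-- In an abelian group every power sum of STPP volumes is at most `k · |H|^e` (`e ≥ 0`), by
`|Aᵢ||Bᵢ||Cᵢ| ≤ |H|`. [cite: CohnUmans2003, Lemma 3.1] -/
theorem sum_rpow_le_card_mul_rpow (hS : AddSimultaneousTPP A B C) {e : ℝ} (he : 0 ≤ e) :
    ∑ i, (((A i).card * (B i).card * (C i).card : ℕ) : ℝ) ^ e ≤
      Fintype.card ι * (Fintype.card H : ℝ) ^ e := by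
  calc ∑ i, (((A i).card * (B i).card * (C i).card : ℕ) : ℝ) ^ e
      ≤ ∑ _i : ι, (Fintype.card H : ℝ) ^ e := by
        refine Finset.sum_le_sum fun i _ => Real.rpow_le_rpow (by positivity) ?_ he
        exact_mod_cast hS.card_mul_card_mul_card_le i
    _ = Fintype.card ι * (Fintype.card H : ℝ) ^ e := by
        rw [Finset.sum_const, nsmul_eq_mul, Finset.card_univ]

/-- **The abelian `k`-triple ceiling.**  If an STPP family with `k = |ι|` triples in a finite abelian group
`H` satisfies the (all-degrees-one) certificate `|H| < Σᵢ (|Aᵢ||Bᵢ||Cᵢ|)^{w/3}` for some `w ≥ 0`, then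
`|H|^{1 − w/3} < k`; equivalently `w > 3 (1 − log k / log |H|)`.
[cite: CohnKleinbergSzegedyUmans2005, Thm. 5.5] -/
theorem card_rpow_lt_card_of_certificate (hS : AddSimultaneousTPP A B C) {w : ℝ} (hw : 0 ≤ w)
    (hcert : (Fintype.card H : ℝ) < ∑ i, (((A i).card * (B i).card * (C i).card : ℕ) : ℝ) ^ (w / 3)) :
    (Fintype.card H : ℝ) ^ (1 - w / 3) < Fintype.card ι := by
  have hHpos : (0 : ℝ) < Fintype.card H := by
    have : 0 < Fintype.card H := Fintype.card_pos
    exact_mod_cast this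
  have hlt : (Fintype.card H : ℝ) < Fintype.card ι * (Fintype.card H : ℝ) ^ (w / 3) :=
    lt_of_lt_of_le hcert (sum_rpow_le_card_mul_rpow hS (by positivity))
  have hpow : (0 : ℝ) < (Fintype.card H : ℝ) ^ (w / 3) := Real.rpow_pos_of_pos hHpos _
  rw [Real.rpow_sub hHpos, Real.rpow_one, div_lt_iff₀ hpow]
  exact hlt

/-- Integer form: if moreover `m (3 − w) ≥ 3` for a natural number `m` (e.g. `m = 6` for `w ≤ 5/2`,
`m = 15` for `w ≤ 14/5`), then `|H| < k^m`. [cite: CohnKleinbergSzegedyUmans2005, Thm. 5.5] -/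
theorem card_lt_pow_of_certificate (hS : AddSimultaneousTPP A B C) {w : ℝ} (hw : 0 ≤ w) {m : ℕ}
    (hm : 3 ≤ (m : ℝ) * (3 - w))
    (hcert : (Fintype.card H : ℝ) < ∑ i, (((A i).card * (B i).card * (C i).card : ℕ) : ℝ) ^ (w / 3)) :
    Fintype.card H < Fintype.card ι ^ m := by
  have hk := card_rpow_lt_card_of_certificate hS hw hcert
  have hHpos : (0 : ℝ) < Fintype.card H := by
    have : 0 < Fintype.card H := Fintype.card_pos
    exact_mod_cast this
  have hH1 : (1 : ℝ) ≤ Fintype.card H := by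
    have : 1 ≤ Fintype.card H := Fintype.card_pos
    exact_mod_cast this
  have hmpos : (0 : ℝ) < m := by
    rcases Nat.eq_zero_or_pos m with h0 | h0
    · subst h0; norm_num at hm
    · exact_mod_cast h0
  -- exponent comparison: `1/m ≤ 1 - w/3`
  have hexp : (1 : ℝ) / m ≤ 1 - w / 3 := by
    rw [div_le_iff₀ hmpos]
    nlinarith
  -- `|H|^{1/m} ≤ |H|^{1 - w/3} < k`, then raise to the `m`-th power
  have h1 : (Fintype.card H : ℝ) ^ ((1 : ℝ) / m) < Fintype.card ι :=
    lt_of_le_of_lt (Real.rpow_le_rpow_of_exponent_le hH1 hexp) hk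
  have h2 : ((Fintype.card H : ℝ) ^ ((1 : ℝ) / m)) ^ (m : ℕ) < (Fintype.card ι : ℝ) ^ (m : ℕ) :=
    pow_lt_pow_left₀ h1 (by positivity) (by exact_mod_cast hmpos.ne')
  have h3 : ((Fintype.card H : ℝ) ^ ((1 : ℝ) / m)) ^ (m : ℕ) = Fintype.card H := by
    rw [← Real.rpow_natCast, ← Real.rpow_mul hHpos.le, one_div_mul_cancel hmpos.ne', Real.rpow_one]
  rw [h3] at h2
  exact_mod_cast h2

/-- **Pairs cannot reach tier T_E outside tiny hosts**: an STPP family with at most two triples in an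
abelian group certifying `w ≤ 5/2` lives in a group of order `< 64`.
[cite: CohnKleinbergSzegedyUmans2005, Thm. 5.5] -/
theorem card_lt_64_of_pair_certificate (hS : AddSimultaneousTPP A B C) (hk : Fintype.card ι ≤ 2)
    {w : ℝ} (hw : 0 ≤ w) (hw' : w ≤ 5 / 2)
    (hcert : (Fintype.card H : ℝ) < ∑ i, (((A i).card * (B i).card * (C i).card : ℕ) : ℝ) ^ (w / 3)) :
    Fintype.card H < 64 := by
  have h := card_lt_pow_of_certificate hS hw (m := 6) (by push_cast; nlinarith) hcert
  calc Fintype.card H < Fintype.card ι ^ 6 := h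
    _ ≤ 2 ^ 6 := Nat.pow_le_pow_left hk 6

/-- **Pairs and tier T_F**: an STPP family with at most two triples in an abelian group certifying
`w ≤ 14/5` lives in a group of order `< 2¹⁵ = 32768` (for `Cyc_n³`: `n ≤ 31`).
[cite: CohnKleinbergSzegedyUmans2005, Thm. 5.5] -/
theorem card_lt_of_pair_certificate_fourteen_fifths (hS : AddSimultaneousTPP A B C)
    (hk : Fintype.card ι ≤ 2) {w : ℝ} (hw : 0 ≤ w) (hw' : w ≤ 14 / 5)
    (hcert : (Fintype.card H : ℝ) < ∑ i, (((A i).card * (B i).card * (C i).card : ℕ) : ℝ) ^ (w / 3)) :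
    Fintype.card H < 32768 := by
  have h := card_lt_pow_of_certificate hS hw (m := 15) (by push_cast; nlinarith) hcert
  calc Fintype.card H < Fintype.card ι ^ 15 := h
    _ ≤ 2 ^ 15 := Nat.pow_le_pow_left hk 15

end STPPAbelianCeiling

end Summit.MatrixMultiplication.MatrixMultiplication.Theorems
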